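import Literature.NumberTheory.EllipticCurves.BDPAnticyclotomicPAdicLFunction
import HarnessLib

/-!
# The branch BDP `p`-adic `L`-function `ℒ_ε = ℒ_𝔭(f)(χ̂ ·)`: the interpolation predicate at conductor `p`

Topic `Literature/NumberTheory/EllipticCurves` (definition item `defn-BranchBDPLFunction`, variant
**(b)** of its specification; BSD route `SchneiderFreeAdditiveX3`, crux r3 `GordTwoBranchIMC` = item
`stmt-BirchSwinnertonDyer-19177`, door memo `door-c3-g8-branch-currency.md` §3 (D)). A characterising
PREDICATE with a body and its definitional API; no named fact, no `sorry`, no instance, no notation.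
The tree's `IsBDPLFunction` (file `BDPAnticyclotomicPAdicLFunction`) is NOT touched.

## Sources (page-read)

* [CastellaHsieh2018] F. Castella, M.-L. Hsieh, *Heegner cycles and `p`-adic `L`-functions*, Math. Ann.
  370 (2018) = arXiv:1505.08165v1 (held `paper:arxiv-1505.08165`, TeX pp. 10–11). §3.3, the
  multiplier (display before Prop. 3.4): "`e_𝔭(f, χ) = (1 - a_p(f) p^{-r} χ_𝔭̄(p) + χ_𝔭̄(p²) p⁻¹)²`
  if `p ∤ c`, `ε(½, χ_𝔭)^{-2}` if `p ∣ c`" (`c𝒪_K` the conductor of `χ`, `2r` the weight of `f`);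
  Def. 3.5 (the measure `ℒ_{𝔭,ψ}(f)` on `Γ̃ = Gal(K_{p^∞}/K)`); **Prop. 3.6**: "If `φ̂ ∈ 𝔛_{p^∞}` is
  the avatar of a Hecke character `φ` of infinity type `(m, -m)` with `m ≥ 0` and `p`-power conductor,
  then `(ℒ_{𝔭,ψ}(f)(φ̂) / Ω_p^{2r+2m})² = L^alg(½, π_K ⊗ ψφ) · e_𝔭(f, ψφ) · φ(𝔑⁻¹) · 2^{#A(ψ)+3} c_o
  ε(f) · u_K² √D_K`" (journal numbering Def. 3.7 / Prop. 3.8), under (Heeg'), (ST), `(c_o, pN⁺) = 1`,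
  `f` of level prime to `p`.
* [Castella2018] F. Castella, Camb. J. Math. 6 (2018), Thm. 3.1 — the reformulation `Tw_{ψ⁻¹}` in
  which the tree states `IsBDPLFunction`: value `Γ(n)Γ(n+1) · (Euler-type factor)² · L(f/K, φ, 1) /
  (π^{2n+1} Ω_K^{4n}) · Ω_p^{4n}` at unramified `φ` of infinity type `(-n, n)`, `n > 0`.
* [KellerYin2024b] T. Keller, M. Yin, arXiv:2410.23241, §3.4 (p. 19): "`ℒ_ε := ℒ_p(f̃)(χ̂_ε ·)`", the
  `χ_ε`-BRANCH of Castella–Hsieh's measure for the genus character `χ_ε` of conductor `p`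
  (PREPRINT; only the name of the object is taken from it — the object is Castella–Hsieh's).
* [TateNTB1979] J. Tate, *Number theoretic background*, (3.2.3)/(3.4.6): for `μ` unramified,
  `ε(s, χμ, ψ) = μ(ϖ)^{a(χ) + n(ψ)} ε(s, χ, ψ)` — the unramified-twist rule for the local constant.

## The predicate

Fix, as for `IsBDPLFunction`, the embedding datum `ι : ℚ̄_p ≃ ℂ`, the distinguished prime `𝔭 ∣ p` of
`K`, the anticyclotomic `ℤ_p`-extension `κ` with topological generator `γ` (`1 + T ↔ γ`), a form
`f ∈ S_2(Γ₀(N))` (MEANT: level prime to `p` — the good-ordinary newform `f̃ = f_{W'}`), CM periods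
`Ω_K ∈ ℂ`, `Ω_p ∈ ℂ_p`; and in addition the BRANCH CHARACTER `χ : HeckeCharacter K` (MEANT: finite
order, anticyclotomic, conductor `p`, i.e. conductor exponent `1` at `𝔭` and at `𝔭̄` — tree
`HeckeCharacter.HasConductorExponentAt χ 𝔭 1`; the genus character `χ_ε = ε_{p*} ∘ N_{K/ℚ}`) and the
BRANCH CONSTANT `e : ℂ` (MEANT: `ε(½, χ_𝔭)^{-2}`, Tate's local root number of `χ_𝔭 : ℚ_p^× → ℂ^×`;
for quadratic `χ_𝔭` it is `χ_𝔭(-1) = ±1`; Tate's local constants are not in the tree, so `e` is a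
parameter exactly like the periods, pinned by the existence fact). Then
**`IsBranchBDPLFunction ι 𝔭 κ γ f χ e Ω_K Ω_p L`** says: for every Hecke character `φ` of `K`
UNRAMIFIED at all finite places, of infinity type `(-n, n)` with `n > 0` (read as in `IsBDPLFunction`),
and every `p`-adic avatar `r` of `φ` factoring through `κ`,

  `L(φ̂(γ) - 1) = ι⁻¹( Γ(n)Γ(n+1) · e · φ(𝔭)^{-2} · L(f/K, χφ, 1) / (π^{2n+1} Ω_K^{4n}) ) · Ω_p^{4n}`,

i.e. the shape of `IsBDPLFunction` with (i) the `L`-value of the TWISTED character `χφ` (of conductor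
`p`: `p ∣ c`) and (ii) Castella's Euler-type factor `(1 - a_p p⁻¹ φ(𝔭) + ε_p φ(𝔭)²)²` (the case
`p ∤ c` of `e_𝔭`) replaced by the case `p ∣ c`: `e_𝔭(f, χφ) = ε(½, (χφ)_𝔭)^{-2} = ε(½, χ_𝔭)^{-2} ·
φ_𝔭(p)^{-2} = e · φ(𝔭)^{-2}` by the unramified-twist rule (`φ` unramified at `𝔭`, `a(χ_𝔭) = 1`,
`n(ψ_𝔭) = 0`), `φ(𝔭) = heckeValueExtZero φ 𝔭` as in `bdpInterpolationValue`. By Weierstrass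
preparation such an `L ∈ R₀⟦T⟧` is unique given `(Ω_K, Ω_p, e)` (infinitely many interpolation points
in the open disc); its value at ONE character is unique by `UnrSeries.HasValueAt.unique`
(`IsBranchBDPLFunction.eq_of_hasValueAt`).

## Scope caveats (recorded, not resolved — the door memo §3 shows its consumers are insensitive to them)

* As in `bdpInterpolationValue`, the value `φ(𝔭)` is read at the distinguished prime `𝔭`;
  Castella–Hsieh's unramified multiplier reads `χ_𝔭̄(p)`, their ramified one `ε(½, χ_𝔭)` at the prime
  `𝔭` of the embedding `ι_p`. The remaining explicit constants of Prop. 3.6 (`φ(𝔑⁻¹)`,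
  `2^{#A(ψ)+3} c_o ε(f) u_K² √D_K`, the `(4π)`/`Im ϑ` normalisation of `L^alg`) are absorbed in
  Castella's reformulation exactly as for `IsBDPLFunction`; this predicate claims nothing about them.
* NOT here: variant (a) of the item (interpolation at ALL `p`-power conductors, which needs Tate's local
  constant `ε(½, φ_𝔭, ψ_𝔭)` as a defined function of `φ`), the existence fact (Castella–Hsieh Def. 3.5 +
  Prop. 3.6 in this currency) and the value formula at finite-order characters (Lemma 5.4 + Thm. 5.7) —
  cite items `wi-73259`/`wi-73260` in the door memo's plan — and any change to `IsBDPLFunction`.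
-/

noncomputable section

open scoped MatrixGroups ModularForm
open CongruenceSubgroup NumberField IsDedekindDomain Field
open Literature.NumberTheory.GaloisRepresentations
open Literature.NumberTheory.EllipticCurves.ModularForms

namespace Literature.NumberTheory.EllipticCurves

universe u

section Branch

variable {K : Type u} [Field K] [NumberField K] {N : ℕ}

/-- **The complex part of the branch interpolation value** at an unramified Hecke character `φ` of
infinity type `(-n, n)`, `n > 0`, on the `χ`-branch: `Γ(n) Γ(n+1) · e · φ(𝔭)^{-2} · L(f/K, χφ, 1) /
(π^{2n+1} · Ω_K^{4n})` — Castella's shape (`bdpInterpolationValue`) with the twisted `L`-value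
`L(f/K, χφ, 1) = rankinSelbergValueHecke f (χ * φ) 1` and Castella–Hsieh's ramified multiplier
`e_𝔭(f, χφ) = ε(½, (χφ)_𝔭)^{-2} = e · φ(𝔭)^{-2}`, `e = ε(½, χ_𝔭)^{-2}` (a parameter),
`φ(𝔭) = heckeValueExtZero φ 𝔭`. The full value is this times `Ω_p^{4n}` (`IsBranchBDPLFunction`).
[cite: CastellaHsieh2018, §3.3 (e_𝔭) and Prop. 3.6] [cite: Castella2018, Thm. 3.1] -/
def bdpBranchInterpolationValue (f : CuspForm (Gamma0 N) 2) (𝔭 : HeightOneSpectrum (𝓞 K))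
    (χ : HeckeCharacter K) (e : ℂ) (φ : HeckeCharacter K) (n : ℕ) (ΩK : ℂ) : ℂ :=
  Complex.Gamma n * Complex.Gamma (n + 1) * (e * (heckeValueExtZero φ 𝔭 ^ 2)⁻¹) *
    rankinSelbergValueHecke f (χ * φ) 1 / ((Real.pi : ℂ) ^ (2 * n + 1) * ΩK ^ (4 * n))

variable {p : ℕ} [Fact p.Prime]

/-- **The interpolation property of the `χ`-branch `ℒ_𝔭(f)(χ̂ ·)` of the Castella–Hsieh / BDP
anticyclotomic `p`-adic `L`-function** (Keller–Yin's `ℒ_ε` for the genus character `χ = χ_ε` of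
conductor `p`), in the currency of the tree's `IsBDPLFunction`: `L ∈ R₀⟦T⟧` (`1 + T ↔ γ`) satisfies,
for every Hecke character `φ` of `K` UNRAMIFIED at all finite places with infinity type `(-n, n)`,
`n > 0` (tree `HasInfinityType (fun _ ↦ n) (fun _ ↦ -n)`), and every `p`-adic avatar `r` of `φ`
(`IsPAdicAvatarOf ι φ r`) factoring through `κ` (`FactorsThroughZp κ r`):

  `L(φ̂(γ) - 1) = ι⁻¹(Γ(n)Γ(n+1) · e · φ(𝔭)^{-2} · L(f/K, χφ, 1) / (π^{2n+1} Ω_K^{4n})) · Ω_p^{4n}`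

(`bdpBranchInterpolationValue` transported along `ι⁻¹ : ℂ → ℚ̄_p ⊂ ℂ_p`). Parameters as in
`IsBDPLFunction` plus the branch character `χ` (meant: finite order, anticyclotomic, conductor `p`)
and the branch constant `e ∈ ℂ` (meant: `ε(½, χ_𝔭)^{-2}`); `f` is meant of level prime to `p`. This is
Castella–Hsieh's Prop. 3.6 at the characters `χφ` of conductor `p` (multiplier `e_𝔭 = ε(½, ·_𝔭)^{-2}`),
read in Castella's reformulation; a characterising PREDICATE, not a construction and not an existence
claim. See the module docstring for the scope caveats (`𝔭` vs `𝔭̄`, absorbed constants).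
[cite: CastellaHsieh2018, Def. 3.5 and Prop. 3.6] [cite: Castella2018, Thm. 3.1] -/
def IsBranchBDPLFunction (ι : PadicAlgCl p ≃+* ℂ) (𝔭 : HeightOneSpectrum (𝓞 K)) (κ : ZpExtension K p)
    (γ : absoluteGaloisGroup K) (f : CuspForm (Gamma0 N) 2) (χ : HeckeCharacter K) (e : ℂ) (ΩK : ℂ)
    (Ωp : ℂ_[p]) (L : UnrSeries p) : Prop :=
  ∀ (φ : HeckeCharacter K) (n : ℕ), 0 < n → (∀ v : HeightOneSpectrum (𝓞 K), φ.IsUnramifiedAt v) →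
    φ.HasInfinityType (fun _ ↦ (n : ℤ)) (fun _ ↦ -(n : ℤ)) →
    ∀ r : FramedGaloisRep K (PadicAlgCl p) 1, IsPAdicAvatarOf ι φ r → FactorsThroughZp κ r →
      L.HasValueAt (avatarValueAt r γ - 1)
        (((ι.symm (bdpBranchInterpolationValue f 𝔭 χ e φ n ΩK) : PadicAlgCl p) : ℂ_[p]) *
          Ωp ^ (4 * n))

/-! #### API -/

variable {ι : PadicAlgCl p ≃+* ℂ} {𝔭 : HeightOneSpectrum (𝓞 K)} {κ : ZpExtension K p}
  {γ : absoluteGaloisGroup K} {f : CuspForm (Gamma0 N) 2} {χ : HeckeCharacter K} {e : ℂ} {ΩK : ℂ}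
  {Ωp : ℂ_[p]} {L : UnrSeries p}

/-- Unfolding `IsBranchBDPLFunction` at one character: the prescribed value at `T = φ̂(γ) - 1`.
[cite: CastellaHsieh2018, Prop. 3.6] -/
theorem IsBranchBDPLFunction.hasValueAt (hL : IsBranchBDPLFunction ι 𝔭 κ γ f χ e ΩK Ωp L)
    {φ : HeckeCharacter K} {n : ℕ} (hn : 0 < n)
    (hunr : ∀ v : HeightOneSpectrum (𝓞 K), φ.IsUnramifiedAt v)
    (hinf : φ.HasInfinityType (fun _ ↦ (n : ℤ)) (fun _ ↦ -(n : ℤ)))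
    {r : FramedGaloisRep K (PadicAlgCl p) 1} (hr : IsPAdicAvatarOf ι φ r) (hκ : FactorsThroughZp κ r) :
    L.HasValueAt (avatarValueAt r γ - 1)
      (((ι.symm (bdpBranchInterpolationValue f 𝔭 χ e φ n ΩK) : PadicAlgCl p) : ℂ_[p]) * Ωp ^ (4 * n)) :=
  hL φ n hn hunr hinf r hr hκ

/-- The prescribed value at a character in the range of interpolation is unique: any `v` with
`L.HasValueAt (φ̂(γ) - 1) v` is the branch right-hand side. [cite: CastellaHsieh2018, Prop. 3.6] -/
theorem IsBranchBDPLFunction.eq_of_hasValueAt (hL : IsBranchBDPLFunction ι 𝔭 κ γ f χ e ΩK Ωp L)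
    {φ : HeckeCharacter K} {n : ℕ} (hn : 0 < n)
    (hunr : ∀ v : HeightOneSpectrum (𝓞 K), φ.IsUnramifiedAt v)
    (hinf : φ.HasInfinityType (fun _ ↦ (n : ℤ)) (fun _ ↦ -(n : ℤ)))
    {r : FramedGaloisRep K (PadicAlgCl p) 1} (hr : IsPAdicAvatarOf ι φ r) (hκ : FactorsThroughZp κ r)
    {v : ℂ_[p]} (hv : L.HasValueAt (avatarValueAt r γ - 1) v) :
    v = ((ι.symm (bdpBranchInterpolationValue f 𝔭 χ e φ n ΩK) : PadicAlgCl p) : ℂ_[p]) * Ωp ^ (4 * n) :=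
  hv.unique (hL.hasValueAt hn hunr hinf hr hκ)

/-- **Two branch `L`-functions with the same parameters agree at every interpolation point**
`T = φ̂(γ) - 1` (the first step of the Weierstrass-preparation uniqueness).
[cite: CastellaHsieh2018, Prop. 3.6] -/
theorem IsBranchBDPLFunction.hasValueAt_iff {L' : UnrSeries p}
    (hL : IsBranchBDPLFunction ι 𝔭 κ γ f χ e ΩK Ωp L) (hL' : IsBranchBDPLFunction ι 𝔭 κ γ f χ e ΩK Ωp L')
    {φ : HeckeCharacter K} {n : ℕ} (hn : 0 < n)
    (hunr : ∀ v : HeightOneSpectrum (𝓞 K), φ.IsUnramifiedAt v)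
    (hinf : φ.HasInfinityType (fun _ ↦ (n : ℤ)) (fun _ ↦ -(n : ℤ)))
    {r : FramedGaloisRep K (PadicAlgCl p) 1} (hr : IsPAdicAvatarOf ι φ r) (hκ : FactorsThroughZp κ r)
    (v : ℂ_[p]) :
    L.HasValueAt (avatarValueAt r γ - 1) v ↔ L'.HasValueAt (avatarValueAt r γ - 1) v :=
  ⟨fun h => hL.eq_of_hasValueAt hn hunr hinf hr hκ h ▸ hL'.hasValueAt hn hunr hinf hr hκ,
    fun h => hL'.eq_of_hasValueAt hn hunr hinf hr hκ h ▸ hL.hasValueAt hn hunr hinf hr hκ⟩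

/-- The branch constant and the `L`-value enter the prescribed value linearly: scaling `e`
scales the value (so `e` and `Ω_p^{4n}`… are genuinely independent parameters only up to this).
[cite: CastellaHsieh2018, §3.3 (e_𝔭)] -/
theorem bdpBranchInterpolationValue_smul (c : ℂ) (f : CuspForm (Gamma0 N) 2) (𝔭 : HeightOneSpectrum (𝓞 K))
    (χ : HeckeCharacter K) (e : ℂ) (φ : HeckeCharacter K) (n : ℕ) (ΩK : ℂ) :
    bdpBranchInterpolationValue f 𝔭 χ (c * e) φ n ΩK = c * bdpBranchInterpolationValue f 𝔭 χ e φ n ΩK := by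
  simp only [bdpBranchInterpolationValue]
  ring

/-- With branch constant `e = 0` the prescribed values vanish. [cite: CastellaHsieh2018, §3.3 (e_𝔭)] -/
theorem bdpBranchInterpolationValue_zero (f : CuspForm (Gamma0 N) 2) (𝔭 : HeightOneSpectrum (𝓞 K))
    (χ : HeckeCharacter K) (φ : HeckeCharacter K) (n : ℕ) (ΩK : ℂ) :
    bdpBranchInterpolationValue f 𝔭 χ 0 φ n ΩK = 0 := by
  simp [bdpBranchInterpolationValue]

/-- Degenerate inhabitant (typing witness, junk parameters): with `Ω_p = 0` the zero series is a branch
`L`-function — all prescribed values are `0` since `n > 0`. The MEANT parameters have `Ω_p ∈ R₀^×`.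
[cite: CastellaHsieh2018, Prop. 3.6] -/
theorem isBranchBDPLFunction_zero_of_periodP_zero (ι : PadicAlgCl p ≃+* ℂ) (𝔭 : HeightOneSpectrum (𝓞 K))
    (κ : ZpExtension K p) (γ : absoluteGaloisGroup K) (f : CuspForm (Gamma0 N) 2) (χ : HeckeCharacter K)
    (e : ℂ) (ΩK : ℂ) : IsBranchBDPLFunction ι 𝔭 κ γ f χ e ΩK 0 0 := by
  intro φ n hn _ _ r _ _
  rw [zero_pow (by omega), mul_zero]
  simp [UnrSeries.HasValueAt]

end Branch

end Literature.NumberTheory.EllipticCurves
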